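import Literature.NumberTheory.GelbartRogawski1991.DoubledUnitaryConj
import Literature.NumberTheory.GelbartRogawski1991.DoubledWeilRepresentationUndoubling
import HarnessLib

/-!
# Undoubling commutes with the conjugation twist: `s(R^𝔻 ∘ sD ∘ (h ↦ h̄)) = R ∘ s(sD) ∘ (g ↦ ḡ)`

Topic `NumberTheory/GelbartRogawski1991`; namespace `Literature.NumberTheory.GelbartRogawski1991.GRConstruction`.  Two definitions BY FORMULA
(`adelicPairConj` = `c ⊗ 1` entrywise on the big group `U(J_V ⊗ J_W)(𝔸)` of a dual pair with `F`-rational `J_V`, `J_W` — the Literature twin of ident-1's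
`pairConj`; `pairConjD` = the same between the diagonal data at `dW′` and `dW = −dW′`) + theorems; no named fact, no `sorry`.  RSCONJ row Ω, ROUTE C
(`HOME/d2bridge/ident/ident-1/omega/OMEGA-ROUTE-C.md` §3, (C3′) L5).

For the doubled data at `dW` (source) and `dW′` (target) with `hneg : realDiagonal dW = −realDiagonal dW′`, a homomorphism `sD : H_{dW}(𝔸) →* Mp(𝕎^𝔻)ᶜᵒⁿᵗ` over
`ι^𝔻` (`hproj`), and its twist `sD′ := R^𝔻 ∘ sD ∘ conjH` (✔-desk `DoubledUnitaryConj`): the UNDOUBLED splitting of `sD′` at `g ∈ G₁(𝔸)` (Kudla's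
`s(g) ⊗ 1 = u(g ⊕ 1)`, ✔ `undouble`) is the relabelling `R` of the undoubled splitting of `sD` at `ḡ`:
**`undouble sD′ g = R (undouble sD ḡ)`** (`undouble_relabel_comp_conjH`), by the uniqueness clause ✔ `undouble_unique`: (a) `π(R p) = Λ π(p) Λ⁻¹ =
Λ ι(ḡ) Λ⁻¹ = ι′(g)` — the PAIR-level (K-b) `symplecticGroupCongr_toSp_pairConjD` (ident-1's mechanism, general `M`); (b) the operators: `R^𝔻`, `R` and
the index change `undoubleIdx` do not move Weil operators (✔ `adelicMpCont.omega_relabel`, `omega_reindex_apply`), and `(g ⊕ 1)‾ = ḡ ⊕ 1` (`conjH_inlG`).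
(The instance of record `isDoubledWeilRep_relabel_comp_conjH` — the `χ`-normalised doubled Weil representation at `dW`, twisted, is
`(χ ∘ c)`-normalised at `dW′` — lives in ✔-desk `DoubledWeilRepresentationRelabel` §4, next to the transport theorem it instantiates.)

Nothing of [GelbartRogawski1991] ∕ [Kudla1994] is asserted.  Cell pub-hodgecm2 (COR-CM).

## References
* [Kudla1994] S. Kudla, Israel J. Math. 87 (1994), §2 (doubled space, Siegel parabolic), §3 Thm. 3.1.
* [GelbartRogawski1991] S. Gelbart, J. Rogawski, Invent. Math. 105 (1991), §3.1 p. 454, §3.2 p. 457.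
* [Kudla1996] S. Kudla, *Notes on the local theta correspondence* (1996), V.3.  [MoeglinVignerasWaldspurger1987] LNM 1291, Chap. 2 II.1.
-/

set_option autoImplicit false

noncomputable section

open scoped Classical
open scoped Matrix Kronecker
open NumberField IsDedekindDomain
open Literature.RepresentationTheory.HeisenbergGroup
open Literature.NumberTheory.Automorphic
open Literature.NumberTheory.Weil1964
open Literature.NumberTheory.GaloisRepresentations

namespace Literature.NumberTheory.GelbartRogawski1991.GRConstruction

open UnitaryDualPair
open Literature.NumberTheory.Automorphic.UnitaryGroup
open Literature.NumberTheory.GaloisRepresentations.HeckeCharacter (complexConj_mul_self)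

/-! ## §0 Entrywise conjugation on the big group of a dual pair (Literature twin of ident-1's `pairConj`) -/

section PairGeneric

variable (F E : Type) [Field F] [NumberField F] [Field E] [NumberField E] [Algebra F E] (c : E ≃ₐ[F] E) (N M : ℕ)
variable {TV : Matrix (Fin N) (Fin N) F} {TW : Matrix (Fin M) (Fin M) F} {JV : Matrix (Fin N) (Fin N) E} {JW : Matrix (Fin M) (Fin M) E}

omit [NumberField F] in
/-- the pair form `J_V ⊗ J_W ⊗ 1` of `F`-rational `J_V`, `J_W` is fixed by `c ⊗ 1`. [folklore] -/
private theorem pairForm_map_conjAdele' (hJV : JV = TV.map (algebraMap F E)) (hJW : JW = TW.map (algebraMap F E)) :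
    (UnitaryGroup.adelicForm E N JV ⊗ₖ UnitaryGroup.adelicForm E M JW).map (conjAdele F E c) =
      UnitaryGroup.adelicForm E N JV ⊗ₖ UnitaryGroup.adelicForm E M JW := by
  rw [← kronecker_map_map, adelicForm_map_conjAdele' F E c N hJV, adelicForm_map_conjAdele' F E c M hJW]

/-- **`g ↦ ḡ = (c ⊗ 1) g` on `G₁(𝔸_F) = U(J_V ⊗ J_W)(𝔸_F)`** for `F`-rational `J_V`, `J_W`. [cite: PlatonovRapinchuk1994, §5.1] -/
def adelicPairConj (hJV : JV = TV.map (algebraMap F E)) (hJW : JW = TW.map (algebraMap F E)) :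
    adelicPair F E c N M JV JW →* adelicPair F E c N M JV JW where
  toFun g := ⟨Matrix.GeneralLinearGroup.map (conjAdele F E c) g.1, by
    have h := map_mem_unitaryGroupOfForm (conjAdele F E c) (τ := conjAdele F E c) (fun _ => rfl) g.2
    rwa [pairForm_map_conjAdele' F E c N M hJV hJW] at h⟩
  map_one' := Subtype.ext (map_one _)
  map_mul' g g' := Subtype.ext (map_mul _ _ _)

omit [NumberField F] in
/-- underlying matrix of `adelicPairConj g`. [cite: PlatonovRapinchuk1994, §5.1] -/
@[simp] theorem coe_adelicPairConj (hJV : JV = TV.map (algebraMap F E)) (hJW : JW = TW.map (algebraMap F E)) (g : adelicPair F E c N M JV JW) :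
    ((adelicPairConj F E c N M hJV hJW g : adelicPair F E c N M JV JW) : GL (Fin N × Fin M) (AdeleRing (𝓞 E) E)) =
      Matrix.GeneralLinearGroup.map (conjAdele F E c) g := rfl

omit [NumberField F] in
/-- `U(J_V ⊗ (−J_W))(𝔸) = U(J_V ⊗ J_W)(𝔸)`. [cite: Kudla1996, V.3] -/
theorem adelicPair_neg' (JV : Matrix (Fin N) (Fin N) E) (JW : Matrix (Fin M) (Fin M) E) :
    adelicPair F E c N M JV (-JW) = adelicPair F E c N M JV JW := by
  have h : UnitaryGroup.adelicForm E M (-JW) = -UnitaryGroup.adelicForm E M JW := Matrix.map_neg _ (map_neg (algebraMap E (AdeleRing (𝓞 E) E))) JW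
  have hk : UnitaryGroup.adelicForm E N JV ⊗ₖ (-UnitaryGroup.adelicForm E M JW) =
      -(UnitaryGroup.adelicForm E N JV ⊗ₖ UnitaryGroup.adelicForm E M JW) := by
    ext ⟨i, i'⟩ ⟨j, j'⟩
    simp [Matrix.kroneckerMap_apply, mul_neg]
  rw [adelicPair, adelicPair, h, hk, unitaryGroupOfForm_neg']

end PairGeneric

/-! ## §1 The pair data at `dW′` and `dW = −dW′`: `g ↦ ḡ`, the Gram matrices, the PAIR-level (K-b) -/

variable (L : Type) [Field L] [NumberField L] [IsCMField L]
variable {N M n : ℕ} (e : Fin N × Fin M ≃ Fin n)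
  (dV : Fin N → L) (hdV : ∀ i, IsCMField.complexConj L (dV i) = dV i) (hdV0 : ∀ i, dV i ≠ 0)
  (dW : Fin M → L) (hdW : ∀ i, IsCMField.complexConj L (dW i) = dW i) (hdW0 : ∀ i, dW i ≠ 0)
  (dW' : Fin M → L) (hdW' : ∀ i, IsCMField.complexConj L (dW' i) = dW' i) (hdW0' : ∀ i, dW' i ≠ 0)

section Pair

variable {L e dV hdV dW hdW dW' hdW'}

/-- `diag dW = −diag dW′` in `M_M(L)` when `realDiagonal dW = −realDiagonal dW′`. [cite: Kudla1996, V.3] -/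
theorem diagonal_eq_neg (hneg : realDiagonal L dW hdW = -realDiagonal L dW' hdW') : Matrix.diagonal dW = -Matrix.diagonal dW' := by
  rw [← realDiagonal_map L dW hdW, ← realDiagonal_map L dW' hdW', hneg, Matrix.map_neg _ (map_neg _)]

/-- the big pair groups at `dW`, `dW′` coincide. [cite: Kudla1996, V.3] -/
theorem adelicPair_eq (hneg : realDiagonal L dW hdW = -realDiagonal L dW' hdW') :
    adelicPair (Fp L) L (IsCMField.complexConj L) N M (Matrix.diagonal dV) (Matrix.diagonal dW) =
      adelicPair (Fp L) L (IsCMField.complexConj L) N M (Matrix.diagonal dV) (Matrix.diagonal dW') := by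
  rw [diagonal_eq_neg hneg, adelicPair_neg']

/-- **`g ↦ ḡ` from the pair group at `dW′` to the pair group at `dW`** (entrywise `c ⊗ 1`, then the identification of the two groups).
[cite: PlatonovRapinchuk1994, §5.1] [cite: Kudla1996, V.3] -/
def pairConjD (hneg : realDiagonal L dW hdW = -realDiagonal L dW' hdW') :
    adelicPair (Fp L) L (IsCMField.complexConj L) N M (Matrix.diagonal dV) (Matrix.diagonal dW') →*
      adelicPair (Fp L) L (IsCMField.complexConj L) N M (Matrix.diagonal dV) (Matrix.diagonal dW) :=
  (MulEquiv.subgroupCongr (adelicPair_eq (dV := dV) hneg).symm).toMonoidHom.comp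
    (adelicPairConj (Fp L) L (IsCMField.complexConj L) N M (realDiagonal_map L dV hdV).symm (realDiagonal_map L dW' hdW').symm)

/-- underlying matrix of `pairConjD g`. [cite: PlatonovRapinchuk1994, §5.1] [cite: Kudla1996, V.3] -/
@[simp] theorem coe_pairConjD (hneg : realDiagonal L dW hdW = -realDiagonal L dW' hdW')
    (g : adelicPair (Fp L) L (IsCMField.complexConj L) N M (Matrix.diagonal dV) (Matrix.diagonal dW')) :
    ((pairConjD (hdV := hdV) hneg g : adelicPair (Fp L) L (IsCMField.complexConj L) N M (Matrix.diagonal dV) (Matrix.diagonal dW)) :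
        GL (Fin N × Fin M) (AdeleRing (𝓞 L) L)) =
      Matrix.GeneralLinearGroup.map (conjAdele (Fp L) L (IsCMField.complexConj L)) g := rfl

omit [IsCMField L] in
/-- `adelicGram e T_V (−T_W) = −adelicGram e T_V T_W`. [cite: Kudla1996, V.3] -/
theorem adelicGram_neg_right (TV : Matrix (Fin N) (Fin N) (Fp L)) (TW : Matrix (Fin M) (Fin M) (Fp L)) :
    adelicGram (Fp L) e TV (-TW) = -adelicGram (Fp L) e TV TW := by
  have hk : TV.map (algebraMap (Fp L) (AdeleRing (𝓞 (Fp L)) (Fp L))) ⊗ₖ (-TW.map (algebraMap (Fp L) (AdeleRing (𝓞 (Fp L)) (Fp L)))) =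
      -(TV.map (algebraMap (Fp L) (AdeleRing (𝓞 (Fp L)) (Fp L))) ⊗ₖ TW.map (algebraMap (Fp L) (AdeleRing (𝓞 (Fp L)) (Fp L)))) := by
    ext ⟨i, i'⟩ ⟨j, j'⟩
    simp [Matrix.kroneckerMap_apply, mul_neg]
  rw [adelicGram, adelicGram, Matrix.map_neg _ (map_neg _), hk, Matrix.reindex_apply, Matrix.reindex_apply]
  rfl

/-- `Tg(dW′) · (−1) = Tg(dW)` (the relabelling hypothesis on the pair Gram matrices). [cite: Kudla1996, V.3] -/
theorem gramA_mul_negOne (hneg : realDiagonal L dW hdW = -realDiagonal L dW' hdW') :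
    gramA L e dV hdV dW' hdW' * (((-1 : GL (Fin n) (AdeleRing (𝓞 (Fp L)) (Fp L))) : GL (Fin n) (AdeleRing (𝓞 (Fp L)) (Fp L))) :
        Matrix (Fin n) (Fin n) (AdeleRing (𝓞 (Fp L)) (Fp L))) = gramA L e dV hdV dW hdW := by
  change adelicGram (Fp L) e (realDiagonal L dV hdV) (realDiagonal L dW' hdW') * _ = adelicGram (Fp L) e (realDiagonal L dV hdV) (realDiagonal L dW hdW)
  rw [hneg, adelicGram_neg_right, Units.val_neg, Units.val_one, Matrix.mul_neg, Matrix.mul_one]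

/-- **`reIm (c̄ ∘ x) = Λ (reIm x)`** read through the enumeration `e` of `Fin N × Fin M`. [cite: MoeglinVignerasWaldspurger1987, Chap. 2 II.1] -/
theorem relabelVec_negOne_reindexW_reIm (x : Fin N × Fin M → AdeleRing (𝓞 L) L) :
    relabelVec (Fp L) (Fin n) (-1) (reindexW (AdeleRing (𝓞 (Fp L)) (Fp L)) e
        (QuadraticCoordinates.reIm (quadraticAdeleEquiv (Fp L) L (IsCMField.complexConj L) (complexConj_imagUnit L) (imagUnit_ne_zero L)).toAddEquiv
          (Fin N × Fin M) x)) =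
      reindexW (AdeleRing (𝓞 (Fp L)) (Fp L)) e
        (QuadraticCoordinates.reIm (quadraticAdeleEquiv (Fp L) L (IsCMField.complexConj L) (complexConj_imagUnit L) (imagUnit_ne_zero L)).toAddEquiv
          (Fin N × Fin M) (conjAdele (Fp L) L (IsCMField.complexConj L) ∘ x)) := by
  have h := isQuadraticCoordinates_adele L (IsCMField.complexConj L) (complexConj_imagUnit L) (imagUnit_ne_zero L) (imagUnit_mul_self L)
  have hσφ : ∀ t, conjAdele (Fp L) L (IsCMField.complexConj L) (AdeleRing.baseChange (Fp L) L t) = AdeleRing.baseChange (Fp L) L t := fun t => by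
    rw [conjAdele_apply, AdeleRing.smul_baseChange]
  have hσδ : conjAdele (Fp L) L (IsCMField.complexConj L) (algebraMap L (AdeleRing (𝓞 L) L) (imagUnit L)) =
      -algebraMap L (AdeleRing (𝓞 L) L) (imagUnit L) := by
    rw [← algebraMap_conj, RingHom.coe_coe, complexConj_imagUnit, map_neg]
  refine Prod.ext ?_ ?_
  · ext i
    simp only [relabelVec_apply, reindexW_apply, Function.comp_apply, QuadraticCoordinates.reIm_apply_fst, h.re_conj hσφ hσδ]
  · ext i
    simp only [relabelVec_apply, reindexW_apply, Units.val_neg, Units.val_one, Matrix.neg_mulVec, Matrix.one_mulVec, Pi.neg_apply,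
      Function.comp_apply, QuadraticCoordinates.reIm_apply_snd, h.im_conj hσφ hσδ]

omit [IsCMField L] in
/-- `Λ⁻¹ = Λ` on `𝔸^n × 𝔸^n`. [folklore] -/
private theorem relabelVec_negOne_symm_apply_pair (v : (Fin n → AdeleRing (𝓞 (Fp L)) (Fp L)) × (Fin n → AdeleRing (𝓞 (Fp L)) (Fp L))) :
    (relabelVec (Fp L) (Fin n) (-1)).symm v = relabelVec (Fp L) (Fin n) (-1) v := by
  have h1 : ((-1 : GL (Fin n) (AdeleRing (𝓞 (Fp L)) (Fp L)))⁻¹ : GL (Fin n) (AdeleRing (𝓞 (Fp L)) (Fp L))) = -1 :=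
    inv_eq_of_mul_eq_one_right (by rw [neg_mul_neg, one_mul])
  rw [relabelVec_symm_apply, relabelVec_apply, h1]

/-- `ι(g) (reindex_e (reIm x)) = reindex_e (reIm (g x))` for the pair embedding at the diagonal data `(diag dV, diag dW₀)`. [folklore] -/
private theorem toSp_diag_apply_reindexW_reIm (dW₀ : Fin M → L) (hdW₀ : ∀ i, IsCMField.complexConj L (dW₀ i) = dW₀ i)
    (g : adelicPair (Fp L) L (IsCMField.complexConj L) N M (Matrix.diagonal dV) (Matrix.diagonal dW₀)) (x : Fin N × Fin M → AdeleRing (𝓞 L) L) :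
    ((toSp (Fp L) L (IsCMField.complexConj L) N M e (Matrix.diagonal dV) (Matrix.diagonal dW₀) (complexConj_imagUnit L) (imagUnit_ne_zero L)
        (imagUnit_mul_self L) (realDiagonal_isSymm L dV hdV) (realDiagonal_isSymm L dW₀ hdW₀) (realDiagonal_map L dV hdV).symm
        (realDiagonal_map L dW₀ hdW₀).symm g : symplecticGroup (polar (adelicForm (Fp L) (Fin n) (gramA L e dV hdV dW₀ hdW₀)))) :
        ((Fin n → AdeleRing (𝓞 (Fp L)) (Fp L)) × (Fin n → AdeleRing (𝓞 (Fp L)) (Fp L))) ≃ₗ[AdeleRing (𝓞 (Fp L)) (Fp L)]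
          ((Fin n → AdeleRing (𝓞 (Fp L)) (Fp L)) × (Fin n → AdeleRing (𝓞 (Fp L)) (Fp L))))
        (reindexW (AdeleRing (𝓞 (Fp L)) (Fp L)) e
          (QuadraticCoordinates.reIm (quadraticAdeleEquiv (Fp L) L (IsCMField.complexConj L) (complexConj_imagUnit L) (imagUnit_ne_zero L)).toAddEquiv
            (Fin N × Fin M) x)) =
      reindexW (AdeleRing (𝓞 (Fp L)) (Fp L)) e
        (QuadraticCoordinates.reIm (quadraticAdeleEquiv (Fp L) L (IsCMField.complexConj L) (complexConj_imagUnit L) (imagUnit_ne_zero L)).toAddEquiv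
          (Fin N × Fin M) ((g : GL (Fin N × Fin M) (AdeleRing (𝓞 L) L)).1 *ᵥ x)) := by
  rw [toSp_apply, coe_spReindex_apply, LinearEquiv.symm_apply_apply]
  exact congrArg _ ((isQuadraticCoordinates_adele L (IsCMField.complexConj L) (complexConj_imagUnit L) (imagUnit_ne_zero L)
    (imagUnit_mul_self L)).toSymplectic_reIm (Fin N × Fin M)
    (isSymm_kronecker ((realDiagonal_isSymm L dV hdV).map _) ((realDiagonal_isSymm L dW₀ hdW₀).map _))
    (fun a => by rw [conjAdele_apply, AdeleRing.smul_baseChange]) (by rw [← algebraMap_conj, RingHom.coe_coe, complexConj_imagUnit L, map_neg])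
    (by rw [adelicForm_eq_map_map L N (realDiagonal L dV hdV) (realDiagonal_map L dV hdV).symm,
      adelicForm_eq_map_map L M (realDiagonal L dW₀ hdW₀) (realDiagonal_map L dW₀ hdW₀).symm, kronecker_map_map]) g x)

/-- **PAIR-level (K-b) at the diagonal data: `Λ ι_{dW}(ḡ) Λ⁻¹ = ι_{dW′}(g)`** (ident-1's `symplecticGroupCongr_toSp_pairConjNeg`, general `M`).
[cite: Kudla1996, V.3] [cite: MoeglinVignerasWaldspurger1987, Chap. 2 II.1] -/
theorem symplecticGroupCongr_toSp_pairConjD (hneg : realDiagonal L dW hdW = -realDiagonal L dW' hdW')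
    (g : adelicPair (Fp L) L (IsCMField.complexConj L) N M (Matrix.diagonal dV) (Matrix.diagonal dW')) :
    symplecticGroupCongr (polar (adelicForm (Fp L) (Fin n) (gramA L e dV hdV dW hdW))) (polar (adelicForm (Fp L) (Fin n) (gramA L e dV hdV dW' hdW')))
        (relabelVec (Fp L) (Fin n) (-1)) (polar_relabelVec (Fp L) (Fin n) (-1) (gramA_mul_negOne (e := e) (dV := dV) (hdV := hdV) hneg))
        (toSp (Fp L) L (IsCMField.complexConj L) N M e (Matrix.diagonal dV) (Matrix.diagonal dW) (complexConj_imagUnit L) (imagUnit_ne_zero L)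
          (imagUnit_mul_self L) (realDiagonal_isSymm L dV hdV) (realDiagonal_isSymm L dW hdW) (realDiagonal_map L dV hdV).symm
          (realDiagonal_map L dW hdW).symm (pairConjD (hdV := hdV) hneg g)) =
      toSp (Fp L) L (IsCMField.complexConj L) N M e (Matrix.diagonal dV) (Matrix.diagonal dW') (complexConj_imagUnit L) (imagUnit_ne_zero L)
        (imagUnit_mul_self L) (realDiagonal_isSymm L dV hdV) (realDiagonal_isSymm L dW' hdW') (realDiagonal_map L dV hdV).symm
        (realDiagonal_map L dW' hdW').symm g := by
  refine Subtype.ext (LinearEquiv.ext fun w => ?_)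
  obtain ⟨x, rfl⟩ : ∃ x : Fin N × Fin M → AdeleRing (𝓞 L) L,
      reindexW (AdeleRing (𝓞 (Fp L)) (Fp L)) e
        (QuadraticCoordinates.reIm (quadraticAdeleEquiv (Fp L) L (IsCMField.complexConj L) (complexConj_imagUnit L) (imagUnit_ne_zero L)).toAddEquiv
          (Fin N × Fin M) x) = w :=
    ⟨(QuadraticCoordinates.reIm (quadraticAdeleEquiv (Fp L) L (IsCMField.complexConj L) (complexConj_imagUnit L) (imagUnit_ne_zero L)).toAddEquiv
        (Fin N × Fin M)).symm ((reindexW (AdeleRing (𝓞 (Fp L)) (Fp L)) e).symm w),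
      by rw [AddEquiv.apply_symm_apply, LinearEquiv.apply_symm_apply]⟩
  have hmat : ((pairConjD (hdV := hdV) hneg g : adelicPair (Fp L) L (IsCMField.complexConj L) N M (Matrix.diagonal dV) (Matrix.diagonal dW)) :
      GL (Fin N × Fin M) (AdeleRing (𝓞 L) L)).1 = g.1.1.map (conjAdele (Fp L) L (IsCMField.complexConj L)) := rfl
  have hmul : g.1.1.map (conjAdele (Fp L) L (IsCMField.complexConj L)) *ᵥ (conjAdele (Fp L) L (IsCMField.complexConj L) ∘ x) =
      conjAdele (Fp L) L (IsCMField.complexConj L) ∘ (g.1.1 *ᵥ x) :=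
    funext fun i => (RingHom.map_mulVec (conjAdele (Fp L) L (IsCMField.complexConj L)) g.1.1 x i).symm
  rw [coe_symplecticGroupCongr_apply, relabelVec_negOne_symm_apply_pair, relabelVec_negOne_reindexW_reIm, toSp_diag_apply_reindexW_reIm,
    toSp_diag_apply_reindexW_reIm, hmat, hmul, relabelVec_negOne_reindexW_reIm, conjAdele_comp_conjAdele_comp']

end Pair

/-! ## §2 `(g ⊕ 1)‾ = ḡ ⊕ 1` -/

section InlG

variable {L e dV hdV dW hdW dW' hdW'}

omit [IsCMField L] in
/-- matrix bookkeeping: `(reindex e₂ (diag (reindex e A, 1)))^f = reindex e₂ (diag (reindex e A^f, 1))` for a ring map `f`. [folklore] -/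
private theorem reindex_fromBlocks_one_map' {R S : Type*} [Semiring R] [Semiring S] (f : R →+* S) (A : Matrix (Fin N × Fin M) (Fin N × Fin M) R) :
    (Matrix.reindex (e₂ (n := n)) (e₂ (n := n)) (Matrix.fromBlocks (Matrix.reindex e e A) 0 0 1)).map f =
      Matrix.reindex (e₂ (n := n)) (e₂ (n := n)) (Matrix.fromBlocks (Matrix.reindex e e (A.map f)) 0 0 1) := by
  simp only [Matrix.reindex_apply, ← Matrix.submatrix_map, Matrix.fromBlocks_map, Matrix.map_zero _ (map_zero f),
    Matrix.map_one _ (map_zero f) (map_one f)]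

/-- **`conjH (g ⊕ 1) = ḡ ⊕ 1`**: `conjH ∘ inlG_{dW′} = inlG_{dW} ∘ pairConjD` (both sides are `reindex e₂ (diag (reindex e ḡ, 1))`, ✔ `coe_inlG`).
[cite: GelbartRogawski1991, §3.1 Prop. 3.1.1 p. 455 L1–2] -/
theorem conjH_inlG (hneg : realDiagonal L dW hdW = -realDiagonal L dW' hdW')
    (g : adelicPair (Fp L) L (IsCMField.complexConj L) N M (Matrix.diagonal dV) (Matrix.diagonal dW')) :
    conjH (e := e) (dV := dV) (hdV := hdV) hneg (inlG L e dV hdV dW' hdW' g) = inlG L e dV hdV dW hdW (pairConjD (hdV := hdV) hneg g) :=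
  Subtype.ext (Units.ext ((coe_coe_conjH (e := e) (dV := dV) (hdV := hdV) hneg (inlG L e dV hdV dW' hdW' g)).trans
    (reindex_fromBlocks_one_map' (e := e) (conjAdele (Fp L) L (IsCMField.complexConj L))
      (((g : adelicPair (Fp L) L (IsCMField.complexConj L) N M (Matrix.diagonal dV) (Matrix.diagonal dW')) :
        GL (Fin N × Fin M) (AdeleRing (𝓞 L) L)) : Matrix (Fin N × Fin M) (Fin N × Fin M) (AdeleRing (𝓞 L) L)))))

end InlG

/-! ## §3 Weil operators along the undoubling index change and `R^𝔻` -/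

section Omega

variable {L e dV hdV dW hdW dW' hdW'}

/-- **`ω(undoubleIdx q) Ψ = R_{e₂⁻¹} (ω(q) (R_{e₂⁻¹}⁻¹ Ψ))`** at one datum (`undoubleIdx = Λ₁ ∘ R_{e₂⁻¹}`; ✔ `omega_relabel`, ✔ `omega_reindex_apply`).
[cite: Kudla1994, §2 (doubled space, Siegel parabolic), Thm. 3.1] -/
theorem omega_undoubleIdx_apply (dW₀ : Fin M → L) (hdW₀ : ∀ i, IsCMField.complexConj L (dW₀ i) = dW₀ i) (q : MpD L e dV hdV dW₀ hdW₀)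
    (Ψ : piSchwartzBruhat (Fp L) (Fin n ⊕ Fin n)) :
    adelicMpCont.omega (Fp L) (Fin n ⊕ Fin n) (gramS L e dV hdV dW₀ hdW₀) (undoubleIdx L e dV hdV dW₀ hdW₀ q) Ψ =
      piSBReindex (Fp L) (e₂ (n := n)).symm
        (adelicMpCont.omega (Fp L) (Fin (n + n)) (gramDA L e dV hdV dW₀ hdW₀) q ((piSBReindex (Fp L) (e₂ (n := n)).symm).symm Ψ)) :=
  -- `undoubleIdx q` is DEFINITIONALLY `Λ₁ (R_{e₂⁻¹} q)`; no `rw` (the two `adelicMpCont` types must not be unified by search)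
  (LinearMap.congr_fun (adelicMpCont.omega_relabel (Fp L) (Fin n ⊕ Fin n) 1 (gramS_mul_one L e dV hdV dW₀ hdW₀)
      (adelicMpContReindex (Fp L) (e₂ (n := n)).symm (gramDA L e dV hdV dW₀ hdW₀) q)) Ψ).trans
    (adelicMpCont.omega_reindex_apply (Fp L) (e₂ (n := n)).symm (gramDA L e dV hdV dW₀ hdW₀) q Ψ)

/-- **the undoubling index change does not see `R^𝔻`**: `ω(undoubleIdx_{dW′} (R^𝔻 m)) = ω(undoubleIdx_{dW} m)` as operators on `𝒮(𝔸^{n ⊔ n})`.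
[cite: Kudla1994, §2 (doubled space, Siegel parabolic), Thm. 3.1] [cite: GelbartRogawski1991, §3.1 p. 454] -/
theorem omega_undoubleIdx_relabel (hneg : realDiagonal L dW hdW = -realDiagonal L dW' hdW') (m : MpD L e dV hdV dW hdW) :
    adelicMpCont.omega (Fp L) (Fin n ⊕ Fin n) (gramS L e dV hdV dW' hdW')
        (undoubleIdx L e dV hdV dW' hdW'
          (adelicMpContRelabel (Fp L) (Fin (n + n)) (-1) (gramDA_mul_negOne (e := e) (dV := dV) (hdV := hdV) hneg) m)) =
      adelicMpCont.omega (Fp L) (Fin n ⊕ Fin n) (gramS L e dV hdV dW hdW) (undoubleIdx L e dV hdV dW hdW m) := by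
  refine LinearMap.ext fun Ψ => ?_
  have h1 := omega_undoubleIdx_apply (e := e) (dV := dV) (hdV := hdV) dW' hdW'
    (adelicMpContRelabel (Fp L) (Fin (n + n)) (-1) (gramDA_mul_negOne (e := e) (dV := dV) (hdV := hdV) hneg) m) Ψ
  have h2 := omega_undoubleIdx_apply (e := e) (dV := dV) (hdV := hdV) dW hdW m Ψ
  have h3 := congrArg (fun T : Module.End ℂ (piSchwartzBruhat (Fp L) (Fin (n + n))) =>
      piSBReindex (Fp L) (e₂ (n := n)).symm (T ((piSBReindex (Fp L) (e₂ (n := n)).symm).symm Ψ)))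
    (adelicMpCont.omega_relabel (Fp L) (Fin (n + n)) (-1) (gramDA_mul_negOne (e := e) (dV := dV) (hdV := hdV) hneg) m)
  exact h1.trans (h3.trans h2.symm)

end Omega

/-! ## §4 Undoubling commutes with the twist: `undouble sD′ g = R (undouble sD ḡ)` -/

section Undouble

variable {L e dV hdV dW hdW dW' hdW'}

/-- `sD′ := R^𝔻 ∘ sD ∘ conjH` lies over `ι′^𝔻` when `sD` lies over `ι^𝔻` (`π′(R m) = Λ π(m) Λ⁻¹`, ✔ `proj_relabel` — `rfl`; the DOUBLED (K-b)
`symplecticGroupCongr_toSpD_conjH`). [cite: GelbartRogawski1991, §3.1 p. 454] -/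
theorem proj_relabel_comp_conjH (hneg : realDiagonal L dW hdW = -realDiagonal L dW' hdW')
    {sD : HA L e dV hdV dW hdW →* MpD L e dV hdV dW hdW} (hproj : ∀ h, projD L e dV hdV dW hdW (sD h) = toSpD L e dV hdV dW hdW h)
    (h : HA L e dV hdV dW' hdW') :
    projD L e dV hdV dW' hdW'
        ((((adelicMpContRelabel (Fp L) (Fin (n + n)) (-1) (gramDA_mul_negOne (e := e) (dV := dV) (hdV := hdV) hneg)).toMonoidHom.comp sD).comp
          (conjH hneg)) h) = toSpD L e dV hdV dW' hdW' h :=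
  -- `((R ∘ sD) ∘ conjH) h` is DEFINITIONALLY `R (sD (conjH h))`; no `rw`
  have e1 : projD L e dV hdV dW' hdW'
        ((adelicMpContRelabel (Fp L) (Fin (n + n)) (-1) (gramDA_mul_negOne (e := e) (dV := dV) (hdV := hdV) hneg)).toMonoidHom
          (sD (conjH hneg h))) =
      symplecticGroupCongr _ _ (relabelVec (Fp L) (Fin (n + n)) (-1))
          (polar_relabelVec (Fp L) (Fin (n + n)) (-1) (gramDA_mul_negOne (e := e) (dV := dV) (hdV := hdV) hneg))
        (projD L e dV hdV dW hdW (sD (conjH hneg h))) :=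
    adelicMpCont.proj_relabel (Fp L) (Fin (n + n)) (-1) (gramDA_mul_negOne (e := e) (dV := dV) (hdV := hdV) hneg) (sD (conjH hneg h))
  e1.trans ((congrArg (symplecticGroupCongr _ _ (relabelVec (Fp L) (Fin (n + n)) (-1))
      (polar_relabelVec (Fp L) (Fin (n + n)) (-1) (gramDA_mul_negOne (e := e) (dV := dV) (hdV := hdV) hneg))) (hproj (conjH hneg h))).trans
    (symplecticGroupCongr_toSpD_conjH hneg h))

/-- **UNDOUBLING COMMUTES WITH THE CONJUGATION TWIST: `undouble sD′ g = R (undouble sD ḡ)`** for `sD′ = R^𝔻 ∘ sD ∘ conjH` over `ι′^𝔻`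
(`hproj′`, e.g. `proj_relabel_comp_conjH`): by ✔ `undouble_unique` at `dW′` — (a) `π′(R p) = Λ ι(ḡ) Λ⁻¹ = ι′(g)` (✔ `proj_relabel`,
✔ `proj_undouble`, PAIR-level (K-b) `symplecticGroupCongr_toSp_pairConjD`); (b) `ω(u′(g))(Φ₁ ⊠ Φ₂) = ω(u(ḡ))(Φ₁ ⊠ Φ₂) = ω(s(ḡ))Φ₁ ⊠ Φ₂ =
ω(R s(ḡ))Φ₁ ⊠ Φ₂` (`conjH_inlG`, `omega_undoubleIdx_relabel`, ✔ `omega_uD_tensorToSum`, ✔ `omega_relabel`).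
[cite: Kudla1994, §2 (doubled space, Siegel parabolic), Thm. 3.1] [cite: GelbartRogawski1991, §3.1 p. 454] -/
theorem undouble_relabel_comp_conjH (hdV0 : ∀ i, dV i ≠ 0) (hdW0 : ∀ i, dW i ≠ 0) (hdW0' : ∀ i, dW' i ≠ 0)
    (hneg : realDiagonal L dW hdW = -realDiagonal L dW' hdW')
    {sD : HA L e dV hdV dW hdW →* MpD L e dV hdV dW hdW} (hproj : ∀ h, projD L e dV hdV dW hdW (sD h) = toSpD L e dV hdV dW hdW h)
    (hproj' : ∀ h, projD L e dV hdV dW' hdW'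
      ((((adelicMpContRelabel (Fp L) (Fin (n + n)) (-1) (gramDA_mul_negOne (e := e) (dV := dV) (hdV := hdV) hneg)).toMonoidHom.comp sD).comp
        (conjH hneg)) h) = toSpD L e dV hdV dW' hdW' h)
    (g : adelicPair (Fp L) L (IsCMField.complexConj L) N M (Matrix.diagonal dV) (Matrix.diagonal dW')) :
    undouble L e dV hdV hdV0 dW' hdW' hdW0' hproj' g =
      adelicMpContRelabel (Fp L) (Fin n) (-1) (gramA_mul_negOne (e := e) (dV := dV) (hdV := hdV) hneg)
        (undouble L e dV hdV hdV0 dW hdW hdW0 hproj (pairConjD (hdV := hdV) hneg g)) := by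
  symm
  refine undouble_unique L e dV hdV hdV0 dW' hdW' hdW0' hproj' g _ ?_ fun Φ₁ Φ₂ => ?_
  · -- (a) `π′(R p) = Λ π(p) Λ⁻¹ = Λ ι(ḡ) Λ⁻¹ = ι′(g)`
    have e1 := adelicMpCont.proj_relabel (Fp L) (Fin n) (-1) (gramA_mul_negOne (e := e) (dV := dV) (hdV := hdV) hneg)
      (undouble L e dV hdV hdV0 dW hdW hdW0 hproj (pairConjD (hdV := hdV) hneg g))
    have e2 := congrArg (symplecticGroupCongr _ _ (relabelVec (Fp L) (Fin n) (-1))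
      (polar_relabelVec (Fp L) (Fin n) (-1) (gramA_mul_negOne (e := e) (dV := dV) (hdV := hdV) hneg)))
      (proj_undouble L e dV hdV hdV0 dW hdW hdW0 hproj (pairConjD (hdV := hdV) hneg g))
    have e3 := symplecticGroupCongr_toSp_pairConjD (e := e) (dV := dV) (hdV := hdV) hneg g
    exact e1.trans (e2.trans e3)
  · -- (b) the product formula for `R p` against `u′(g)`: `u′(g) = undoubleIdx′ (R^𝔻 (sD (conjH (g ⊕ 1))))` DEFINITIONALLY
    have u1 := omega_undoubleIdx_relabel (e := e) (dV := dV) (hdV := hdV) hneg (sD (conjH hneg (inlG L e dV hdV dW' hdW' g)))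
    have u2 := congrArg (fun h : HA L e dV hdV dW hdW =>
        adelicMpCont.omega (Fp L) (Fin n ⊕ Fin n) (gramS L e dV hdV dW hdW) (undoubleIdx L e dV hdV dW hdW (sD h))) (conjH_inlG hneg g)
    have u3 : adelicMpCont.omega (Fp L) (Fin n ⊕ Fin n) (gramS L e dV hdV dW' hdW')
          (uD L e dV hdV dW' hdW'
            (((adelicMpContRelabel (Fp L) (Fin (n + n)) (-1) (gramDA_mul_negOne (e := e) (dV := dV) (hdV := hdV) hneg)).toMonoidHom.comp sD).comp
              (conjH hneg)) g) =
        adelicMpCont.omega (Fp L) (Fin n ⊕ Fin n) (gramS L e dV hdV dW hdW) (uD L e dV hdV dW hdW sD (pairConjD (hdV := hdV) hneg g)) :=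
      u1.trans u2
    have u4 := omega_uD_tensorToSum L e dV hdV hdV0 dW hdW hdW0 hproj (pairConjD (hdV := hdV) hneg g) Φ₁ Φ₂
    have u5 := congrArg (fun T : Module.End ℂ (piSchwartzBruhat (Fp L) (Fin n)) => tensorToSum (Fp L) (Fin n) (Fin n) (T Φ₁) Φ₂)
      (adelicMpCont.omega_relabel (Fp L) (Fin n) (-1) (gramA_mul_negOne (e := e) (dV := dV) (hdV := hdV) hneg)
        (undouble L e dV hdV hdV0 dW hdW hdW0 hproj (pairConjD (hdV := hdV) hneg g)))
    exact (LinearMap.congr_fun u3 (tensorToSum (Fp L) (Fin n) (Fin n) Φ₁ Φ₂)).trans (u4.trans u5.symm)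

/-- **Hom form: `undoubleHom sD′ = R ∘ undoubleHom sD ∘ (g ↦ ḡ)`.** [cite: Kudla1994, §2 (doubled space, Siegel parabolic), Thm. 3.1]
[cite: GelbartRogawski1991, §3.1 p. 454] -/
theorem undoubleHom_relabel_comp_conjH (hdV0 : ∀ i, dV i ≠ 0) (hdW0 : ∀ i, dW i ≠ 0) (hdW0' : ∀ i, dW' i ≠ 0)
    (hneg : realDiagonal L dW hdW = -realDiagonal L dW' hdW')
    {sD : HA L e dV hdV dW hdW →* MpD L e dV hdV dW hdW} (hproj : ∀ h, projD L e dV hdV dW hdW (sD h) = toSpD L e dV hdV dW hdW h)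
    (hproj' : ∀ h, projD L e dV hdV dW' hdW'
      ((((adelicMpContRelabel (Fp L) (Fin (n + n)) (-1) (gramDA_mul_negOne (e := e) (dV := dV) (hdV := hdV) hneg)).toMonoidHom.comp sD).comp
        (conjH hneg)) h) = toSpD L e dV hdV dW' hdW' h) :
    undoubleHom L e dV hdV hdV0 dW' hdW' hdW0'
        (((adelicMpContRelabel (Fp L) (Fin (n + n)) (-1) (gramDA_mul_negOne (e := e) (dV := dV) (hdV := hdV) hneg)).toMonoidHom.comp sD).comp
          (conjH hneg)) hproj' =
      ((adelicMpContRelabel (Fp L) (Fin n) (-1) (gramA_mul_negOne (e := e) (dV := dV) (hdV := hdV) hneg)).toMonoidHom.comp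
          (undoubleHom L e dV hdV hdV0 dW hdW hdW0 sD hproj)).comp (pairConjD (hdV := hdV) hneg) :=
  MonoidHom.ext fun g => undouble_relabel_comp_conjH hdV0 hdW0 hdW0' hneg hproj hproj' g

end Undouble

end Literature.NumberTheory.GelbartRogawski1991.GRConstruction

end
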